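import Summits.QuantumFields.YangMills.Theorems.BalabanUVNodesN18KingModel
import Literature.MathematicalPhysics.QuantumFieldTheory.King1986.MinimizerTwoSpacingDecay

/-!
# BalabanUVNodes ∕ N18 — `T4OutputRate.NE5` WITH A RATE `θ < 1` AND A DECAY EXPONENT `κ > 0`, inhabited
# UNCONDITIONALLY by the printed model in its PRINTED SHAPE: King 1986 Prop. 3.8 (3.71) line 1
# `≦ CL^{−γ′k}exp[−δ₀′|x − z|]` on Bałaban's tori (`King1986.Torus.king_prop38_torus_printed`) BY NAME (Track A, node N18)

HONEST FRAMING.  Count-neutral kernel bookkeeping; NOT a node discharge.  Companion of `BalabanUVNodesN18KingModel`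
(p411731): there `ne5_of_kingModel_decay` knits `T4OutputRate.NE5 EA EB W (δ₀∕2) (L^{−γ∕2}) √(2c₀C₅)` at every carrier
reading King's `A = 0` minimiser kernels, UNDER two binders — Theorem 3.3's decay of both kernels in the carriers' tree
length.  The twin seat `dag-n18-b` has since LANDED the decay (`King1986/MinimizerTowerBridge.lean` p411423:
`minimiser_kernel_decay` = [King1986] Thm 3.3 ∕ [Balaban1983RegularityDecay] (1.10) transported from lit-balaban's
`B4Thm110ZeroTorus.thm110_zero_torus`; `King1986/MinimizerTwoSpacingDecay.lean`: `minimiser_kernel_decay_labels`,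
`king_prop38_torus_printed` = (3.71) line 1 in its printed shape, unconditional on Bałaban's volumes `M_μ = 2L^m`).  This
file discharges the two binders BY NAME: on the unit torus `M_μ = 2L^m` of Bałaban's volumes `(d, L, m, k)`, for every
carrier whose domains read, at scale `k = scale X ≥ 1`, a unit site `b`, fine points `x_B` over `x_A`, the SAME points as
labelled points of the B1∕B4 tower's tori (the dictionary of `MinimizerTowerBridge`, label equalities as in
`king_prop38_torus_printed`), and a tree length `d X` not exceeding the physical sup-distance from `x_A` (resp. `x_B`) to
the block of `b` (King's `|x − z|`; `B5Ineq137Torus.T` in lattice units × `ε`), and whose functionals read King's kernels: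
`NE5 EA EB W (δ₀∕2) (L^{−γ∕2}) √(2ac₀·C₅(a, L, d, γ))` for EVERY window `W`, with `δ₀, c₀ > 0` depending on `d, L, a, m²`
only (the `∃` of Theorem 3.3's constants, uniform in the volume), `θ = L^{−γ∕2} < 1` for `γ > 0`, ONE constant for all
scales.  THE MODEL: King's `A = 0` scalar minimiser kernels ([King1986], template literature, printed and proved) — NOT
Bałaban's covariant one-step outputs, for which NE5 is NOT IN PRINT (NODE O instance 0∕1).  One finite torus at a time;
nothing continuum ∕ ℝ⁴ ∕ OS ∕ mass-gap ∕ Clay.  0 `sorry`, 0 `def`, standard axioms.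

Sources: C. King, Commun. Math. Phys. **102** (1986) 649–677 [King1986], Prop. 3.8 (3.71) p. 664, Thm 3.3 p. 658, p. 674,
p. 665; T. Bałaban, Commun. Math. Phys. **89** (1983) 571–597 [Balaban1983RegularityDecay] Theorem (1.10) p. 573 (King's
[Ba 4]); T. Bałaban, Commun. Math. Phys. **109** (1987) [Balaban1987RG1] Thm 1 p. 259 (uniformity in ε — the only printed
trace of NE5).  Nothing here is a claim about the Yang–Mills mass gap.
-/

noncomputable section

namespace Summit.QuantumFields.YangMills.BalabanUVNodes.N18KingModel

open Real
open Literature.MathematicalPhysics.QuantumFieldTheory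
open Literature.MathematicalPhysics.QuantumFieldTheory.Balaban1983to89.T4OutputRate (Carriers Functional NE5)
open Literature.MathematicalPhysics.QuantumFieldTheory.Balaban1983to89.B5Prop11Plancherel (Tor fine)
open Literature.MathematicalPhysics.QuantumFieldTheory.King1986 (aK aK_le prop38RateConst prop38PosConst)
open Literature.MathematicalPhysics.QuantumFieldTheory.King1986.Torus (minimiser minimiser_kernel_decay_labels)

variable {dd : ℕ}

/-- **N18's DECL OF RECORD WITH `θ < 1` AND `κ > 0`, INHABITED UNCONDITIONALLY BY THE PRINTED MODEL IN ITS PRINTED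
SHAPE.**  Fix `d ≥ 1`, an odd block size `L > 1`, the volume exponent `m` (unit torus `M_μ = 2L^m` of Bałaban's volumes
`(d, L, m, k)`), `n ≥ 1`, King's `a > 0`, `m² > 0` and `0 ≤ γ ≤ 1`.  There are `δ₀, c₀ > 0` (Theorem 3.3's constants,
functions of `d, L, a, m²` only — `minimiser_kernel_decay_labels`) such that: for EVERY carrier `C` with creation scales
`≥ 1` whose domains read a unit site `b(X)`, run A's fine point `x_A(X)` on the torus of `L^k` points per block side
(`k = scale X`) UNDER run B's `x_B(X)` (`L^nL^k` points), the same three as labelled points `x, x′, b, b′` of the tower's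
tori of the volumes `(d, L, m, k)` and `(d, L, m, k + n)`, and a tree length `d X ≤ ε·T(x, z)`, `d X ≤ ε′·T(x′, z′)` for
all finest-lattice points `z`, `z′` of the block of `b` (King's `|x − z|`), and for EVERY pair of functionals reading
`EA g U X = ℋ_k(x_A(X), b(X))`, `EB g U X = ℋ_{k+n}(x_B(X), b(X))` (King's ACTUAL `A = 0` minimiser kernels of
`EffectiveLaplacianSymbol`, coefficient `a_k`, `c = L^{2k}`), and every window `W`:
`NE5 EA EB W (δ₀∕2) (L^{−γ∕2}) √(2ac₀·C₅(a, L, d, γ))` — (3.71) line 1 `CL^{−γ′k}e^{−δ₀′|x−z|}` BY NAME in the node's shape,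
ONE constant for all scales.  Composition: `ne5_of_kingModel_decay` (p411731) with its two decay binders discharged by
`minimiser_kernel_decay_labels` (run A at `N = L^k`, run B at `N = L^nL^k = L^{k+n}`, `a_j ≤ a`).
[cite: King1986, Prop. 3.8 (3.71) p.664, Thm 3.3 p.658, p.674, p.665; Balaban1983RegularityDecay, Theorem (1.10) p.573] -/
theorem ne5_of_kingModel_printed (hd : 1 ≤ dd) {L : ℕ} [NeZero L] (hLp : Odd L ∧ 1 < L) (m : ℕ) {n : ℕ}
    (hn : 1 ≤ n) {a m2 : ℝ} (ha : 0 < a) (hm : 0 < m2) {γ : ℝ} (hγ0 : 0 ≤ γ) (hγ1 : γ ≤ 1) :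
    ∃ δ₀ c₀ : ℝ, 0 < δ₀ ∧ 0 < c₀ ∧
      ∀ (M : Fin dd → ℕ) [∀ μ, NeZero (M μ)] (_hM : ∀ μ, M μ = 2 * L ^ m)
        (C : Carriers) (_hscale : ∀ X, 1 ≤ C.scale X) (site : C.Dom → Tor M)
        (xA : (X : C.Dom) → Tor (fine (L ^ C.scale X) M))
        (xB : (X : C.Dom) → Tor (fine (L ^ n * L ^ C.scale X) M))
        (_hx : ∀ X μ, (xA X μ).val = (xB X μ).val / L ^ n)
        (xT : (X : C.Dom) → Balaban1983to89.Site (⟨dd, L, m, C.scale X, hd, hLp⟩ : Balaban1983to89.Params) 0)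
        (xT' : (X : C.Dom) → Balaban1983to89.Site (⟨dd, L, m, C.scale X + n, hd, hLp⟩ : Balaban1983to89.Params) 0)
        (bT : (X : C.Dom) → Balaban1983to89.Site (⟨dd, L, m, C.scale X, hd, hLp⟩ : Balaban1983to89.Params) (C.scale X))
        (bT' : (X : C.Dom) → Balaban1983to89.Site (⟨dd, L, m, C.scale X + n, hd, hLp⟩ : Balaban1983to89.Params) (C.scale X + n))
        (_hxT : ∀ X μ, (xA X μ).val = (xT X μ).val) (_hxT' : ∀ X μ, (xB X μ).val = (xT' X μ).val)
        (_hbT : ∀ X μ, (site X μ).val = (bT X μ).val) (_hbT' : ∀ X μ, (site X μ).val = (bT' X μ).val)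
        (_hdA : ∀ X (z : Balaban1983to89.Site (⟨dd, L, m, C.scale X, hd, hLp⟩ : Balaban1983to89.Params) 0),
          Balaban1983to89.Site.proj (C.scale X) (C.scale X) z = bT X →
          C.d X ≤ (⟨dd, L, m, C.scale X, hd, hLp⟩ : Balaban1983to89.Params).eps *
            Balaban1983to89.B5Ineq137Torus.T (⟨dd, L, m, C.scale X, hd, hLp⟩ : Balaban1983to89.Params) 0 (xT X) z)
        (_hdB : ∀ X (z' : Balaban1983to89.Site (⟨dd, L, m, C.scale X + n, hd, hLp⟩ : Balaban1983to89.Params) 0),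
          Balaban1983to89.Site.proj (C.scale X + n) (C.scale X + n) z' = bT' X →
          C.d X ≤ (⟨dd, L, m, C.scale X + n, hd, hLp⟩ : Balaban1983to89.Params).eps *
            Balaban1983to89.B5Ineq137Torus.T (⟨dd, L, m, C.scale X + n, hd, hLp⟩ : Balaban1983to89.Params) 0
              (xT' X) z')
        (EA : Functional C C.BgA) (EB : Functional C C.BgB)
        (_hEA : ∀ g U X, EA g U X =
          minimiser (L ^ C.scale X) M (aK a L (C.scale X)) (((L ^ C.scale X : ℕ) : ℝ) ^ 2) m2
            (Pi.single (site X) 1) (xA X))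
        (_hEB : ∀ g U X, EB g U X =
          minimiser (L ^ n * L ^ C.scale X) M (aK a L (C.scale X + n)) (((L ^ n * L ^ C.scale X : ℕ) : ℝ) ^ 2) m2
            (Pi.single (site X) 1) (xB X))
        (W : Set (ℕ → ℝ)),
        NE5 EA EB W (δ₀ / 2) ((L : ℝ) ^ (-(γ / 2)))
          (Real.sqrt (2 * (a * c₀) *
            (prop38RateConst a a (a * (2 * ((a * (1 - ((L : ℝ) ^ 2)⁻¹))⁻¹ + π ^ 2 / 48 + 1 / 3))) ((π ^ 2 / 4) ^ dd) dd γ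
              + prop38PosConst a ((π ^ 2 / 4) ^ dd) dd γ))) := by
  obtain ⟨δ₀, c₀, hδ₀, hc₀, H⟩ := minimiser_kernel_decay_labels dd L hd hLp ha hm.le
  refine ⟨δ₀, c₀, hδ₀, hc₀, ?_⟩
  intro M _ hM C hscale site xA xB hx xT xT' bT bT' hxT hxT' hbT hbT' hdA hdB EA EB hEA hEB W
  have hdd : 0 < dd := hd
  have hL2 : 2 ≤ L := by have := hLp.2; omega
  have hLr : (1 : ℝ) < L := by exact_mod_cast hLp.2
  refine ne5_of_kingModel_decay hdd hLp.1 hL2 hn M ha hm hγ0 hγ1 C hscale site xA xB hx EA EB hEA hEB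
    (c₀ := a * c₀) (δ₀ := δ₀) (fun X => ?_) (fun X => ?_) W
  · -- run A: volume `(d, L, m, k)`, `N = L^k`, Theorem 3.3 at distance `d X ∕ ε`
    have hk := hscale X
    have hε : 0 < (⟨dd, L, m, C.scale X, hd, hLp⟩ : Balaban1983to89.Params).eps := Balaban1983to89.Params.eps_pos _
    have hMK : ∀ μ, M μ = (⟨dd, L, m, C.scale X, hd, hLp⟩ : Balaban1983to89.Params).sitesPerDir (C.scale X) := fun μ => by
      rw [hM μ]; simp only [Balaban1983to89.Params.sitesPerDir, Nat.add_sub_cancel]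
    have h := H ⟨dd, L, m, C.scale X, hd, hLp⟩ rfl rfl hk M hMK (L ^ C.scale X) rfl (xA X) (xT X) (hxT X)
      (site X) (bT X) (hbT X) (C.d X / (⟨dd, L, m, C.scale X, hd, hLp⟩ : Balaban1983to89.Params).eps)
      (div_nonneg (C.d_nonneg X) hε.le)
      (fun z hz => by rw [div_le_iff₀ hε, mul_comm]; exact hdA X z hz)
    rw [mul_div_cancel₀ _ hε.ne'] at h
    exact h.trans (mul_le_mul_of_nonneg_right
      (mul_le_mul_of_nonneg_right (aK_le ha hLr hk) hc₀.le) (Real.exp_pos _).le)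
  · -- run B: volume `(d, L, m, k + n)` (same unit torus), `N = L^nL^k = L^{k+n}`
    have hk := hscale X
    have hε : 0 < (⟨dd, L, m, C.scale X + n, hd, hLp⟩ : Balaban1983to89.Params).eps := Balaban1983to89.Params.eps_pos _
    have hMK : ∀ μ, M μ = (⟨dd, L, m, C.scale X + n, hd, hLp⟩ : Balaban1983to89.Params).sitesPerDir (C.scale X + n) := fun μ => by
      rw [hM μ]; simp only [Balaban1983to89.Params.sitesPerDir, Nat.add_sub_cancel]
    have hN : L ^ n * L ^ C.scale X = L ^ (C.scale X + n) := by rw [pow_add, mul_comm]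
    have h := H ⟨dd, L, m, C.scale X + n, hd, hLp⟩ rfl rfl (show 1 ≤ C.scale X + n by omega) M hMK (L ^ n * L ^ C.scale X) hN (xB X)
      (xT' X) (hxT' X) (site X) (bT' X) (hbT' X) (C.d X / (⟨dd, L, m, C.scale X + n, hd, hLp⟩ : Balaban1983to89.Params).eps)
      (div_nonneg (C.d_nonneg X) hε.le)
      (fun z hz => by rw [div_le_iff₀ hε, mul_comm]; exact hdB X z hz)
    rw [mul_div_cancel₀ _ hε.ne'] at h
    exact h.trans (mul_le_mul_of_nonneg_right
      (mul_le_mul_of_nonneg_right (aK_le ha hLr (show 1 ≤ C.scale X + n by omega)) hc₀.le)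
      (Real.exp_pos _).le)

/-- The letters of the printed-shape instance have CONTENT: `0 < δ₀∕2` and, for `γ > 0`, `L^{−γ∕2} < 1` — a decay
exponent AND a rate, which one-run envelopes alone never give (`BalabanUVNodesN18End.ne5_of_decayBounds_one_le` needs
`θ ≥ 1`). [cite: King1986, Prop. 3.8 (3.71) p.664] -/
theorem printed_letters_content {L : ℕ} (hL : 2 ≤ L) {γ δ₀ : ℝ} (hγ : 0 < γ) (hδ₀ : 0 < δ₀) :
    0 < δ₀ / 2 ∧ 0 < (L : ℝ) ^ (-(γ / 2)) ∧ (L : ℝ) ^ (-(γ / 2)) < 1 :=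
  ⟨half_pos hδ₀, kingTheta_pos (by omega) _, kingTheta_lt_one hL (half_pos hγ)⟩

end Summit.QuantumFields.YangMills.BalabanUVNodes.N18KingModel

end
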